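import Summits.QuantumFields.GaugeBoot.ClassBIdentification
import Summits.QuantumFields.GaugeBoot.DiagonalRPFiniteVolume
import Literature.MathematicalPhysics.QuantumFieldTheory.Balaban1983to89.InfiniteVolumeSufficientX
import HarnessLib

/-!
# Class B holds wherever the DLR state is unique — in particular for `SU(N)` at strong coupling
(gauge-boot, L3(α))

HONEST FRAMING (cell `pub-gaugeboot`, page 1 of every file): the venture produces certified bounds
on lattice expectations at stated coupling, gauge group, dimension and torus size; NOT a mass gap,
NOT a continuum limit, NOT a string tension; NOT Yang–Mills-summit-bearing (barriers
`FixedCouplingUltralocality`, `PerturbativeInvisibility`). This file is a STRONG-COUPLING statement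
about lattice states; nothing is claimed at the couplings of the cell's certificates.

`ClassBIdentification.lean` reduced the OPEN identification `ThermodynamicLimitIsClassB d ρ β`
("every infinite-volume limit point of the torus Wilson states is a Class-B state") to
`TorusLimitPointsDiagonalRP d ρ β` (reflection positivity of the limit points in the diagonal
hyperplanes `x_i = x_j`). Here that remaining conjunct is PROVED under DLR uniqueness, exactly as
anticipated in the docstring of `ThermodynamicLimitIsClassB` ("known where the infinite-volume state
is unique — then torus and box limits agree and the box states carry diagonal RP"):

* `mem_ymGibbsMeasures_of_tendsto_ymSpecification` — Georgii's Thm. 4.17 for boundary-condition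
  kernels: a weak limit of Wilson–DLR kernels `γ_{Λ_k}(· | η_k)` along volumes exhausting the links
  of `ℤ^d` is a DLR state (Feller property + consistency of the tree's specification
  `ymSpecification`, then `mem_ymGibbsMeasures_of_forall_integral_eq`);
* `tendsto_integral_ymSpecification_of_subsingleton` — if `|𝒢(β)| ≤ 1` and `μ ∈ 𝒢(β)`, then
  `∫ F dγ_{Λ_k}(· | η_k) → ∫ F dμ` for every bounded continuous `F` (compactness of the space of
  probability measures on the compact metrisable configuration space + the previous item);
* `diagRP_of_mem_infiniteVolumeLimitPoints_of_subsingleton` — hence, for `β ≥ 0`, every torus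
  limit point is diagonal-RP: it is the weak limit of the unit-boundary-condition kernels of the
  symmetric cubes `[-n, n]^d`, each of which is diagonal-RP
  (`DiagRP.isReflectionPositiveFor_diag_ymSpecification_box`), and RP passes to the limit on
  continuous cylinder observables and then to all bounded measurable half-space observables
  (`IsReflectionPositiveFor.of_continuous_cylinder`);
* `thermodynamicLimitIsClassB_of_subsingleton` — **Class B holds at every `β ≥ 0` at which the
  DLR state is unique**;
* `thermodynamicLimitIsClassB_SU_strongCoupling` — **for `SU(N)`, `d ≥ 2`, `N ≥ 2` and 't Hooft
  coupling `0 ≤ β < 1/(16(d-1))` (bare coupling `Nβ`, fundamental representation) every torus limit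
  point is a Class-B state**, by the tree's kernel theorem of DLR uniqueness at strong coupling
  (`subsingleton_ymGibbsMeasures_SU_strongCoupling`, Shen–Zhu–Zhu CMP 400 (2023) as proved in the
  tree). At these couplings the Class-B axioms of the lattice bootstrap (Kazakov–Zheng) are thus
  THEOREMS about the (unique) infinite-volume `SU(N)` lattice Yang–Mills state; at larger `β`
  (all the cell's certificate couplings) the diagonal family remains an open question
  (`TorusLimitPointsDiagonalRP`).

References: H.-O. Georgii, Gibbs Measures and Phase Transitions (2011), Thm. 4.17;
K. Osterwalder, E. Seiler, Ann. Phys. 110 (1978) 440, §4; H. Shen, R. Zhu, X. Zhu,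
Comm. Math. Phys. 400 (2023); V. Kazakov, Z. Zheng, arXiv:2203.11360 §2 (loop equations), §3.1 (reflection
positivities).
-/

noncomputable section

open MeasureTheory Filter Topology ProbabilityTheory
open scoped ComplexOrder ComplexConjugate
open Literature.Probability.LatticeModels (Site box mem_box IsSpecification)
open Literature.MathematicalPhysics.QuantumLattice
open Literature.MathematicalPhysics.QuantumFieldTheory (isSpecification_ymSpecification_of_t2Space
  mem_ymGibbsMeasures_of_forall_integral_eq subsingleton_ymGibbsMeasures_SU_strongCoupling)

namespace Summit.QuantumFields.GaugeBoot

variable {d N : ℕ} {G : Type*} [Group G] [TopologicalSpace G] [IsTopologicalGroup G]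
  [CompactSpace G] [MeasurableSpace G] [BorelSpace G] [T2Space G] [SecondCountableTopology G]
variable (ρ : G →* Matrix (Fin N) (Fin N) ℂ)

/-! ## Weak limits of boundary-condition kernels are DLR states -/

section KernelLimits

/-- **Consistency of the Wilson specification, integral form**: for `Λ ⊆ Λ'`,
`∫ (γ_Λ f) dγ_{Λ'}(· | η) = ∫ f dγ_{Λ'}(· | η)` for every `γ_{Λ'}(· | η)`-integrable `f`. -/
theorem integral_integral_ymSpecification_of_subset (hρ : Continuous ρ) (β : ℝ)
    {Λ Λ' : Finset (ZdEdge d)} (h : Λ ⊆ Λ') (η : LGConfig d G) {f : LGConfig d G → ℝ}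
    (hf : Integrable f (ymSpecification ρ β Λ' η)) :
    ∫ σ, ∫ U, f U ∂(ymSpecification ρ β Λ σ) ∂(ymSpecification ρ β Λ' η) =
      ∫ U, f U ∂(ymSpecification ρ β Λ' η) := by
  -- adapted from `Literature/MathematicalPhysics/QuantumLattice/LatticeFieldShellMarkov.lean`
  -- (`integral_integral_eq_of_lintegral_eq`)
  have hγ := isSpecification_ymSpecification_of_t2Space (d := d) ρ hρ β
  have hbind : (ymSpecification ρ β Λ' η).bind (ymSpecification ρ β Λ) = ymSpecification ρ β Λ' η := by
    ext A hA
    rw [Measure.bind_apply hA (hγ.measurable_fun Λ).aemeasurable]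
    exact hγ.consistent h η A hA
  let κ : Kernel (LGConfig d G) (LGConfig d G) := ⟨ymSpecification ρ β Λ, hγ.measurable_fun Λ⟩
  have hcomp : (κ ∘ₖ Kernel.const Unit (ymSpecification ρ β Λ' η)) () = ymSpecification ρ β Λ' η := by
    rw [Kernel.comp_apply, Kernel.const_apply]
    exact hbind
  have hfi : Integrable f ((κ ∘ₖ Kernel.const Unit (ymSpecification ρ β Λ' η)) ()) := by rwa [hcomp]
  have key := Kernel.integral_comp hfi
  rw [hcomp, Kernel.const_apply] at key
  exact key.symm

/-- **Weak limits of boundary-condition kernels are DLR states** (Georgii 2011, Thm. 4.17, for the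
Wilson specification): if the probability measures `P k = γ_{Λ_k}(· | η_k)` converge weakly to `ν`
along finite link sets `Λ_k` that eventually contain every finite set, then `ν ∈ 𝒢(β)`. -/
theorem mem_ymGibbsMeasures_of_tendsto_ymSpecification (hρ : Continuous ρ) (β : ℝ)
    {Λ : ℕ → Finset (ZdEdge d)} (hΛ : ∀ Λ₀ : Finset (ZdEdge d), ∀ᶠ k in atTop, Λ₀ ⊆ Λ k)
    (η : ℕ → LGConfig d G) {P : ℕ → ProbabilityMeasure (LGConfig d G)}
    (hP : ∀ k, (P k : Measure (LGConfig d G)) = ymSpecification ρ β (Λ k) (η k))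
    {ν : ProbabilityMeasure (LGConfig d G)} (hlim : Tendsto P atTop (𝓝 ν)) :
    (ν : Measure (LGConfig d G)) ∈ ymGibbsMeasures ρ β := by
  refine mem_ymGibbsMeasures_of_forall_integral_eq ρ hρ β (μ := (ν : Measure (LGConfig d G)))
    fun Λ₀ F S₀ _ hFc C hC => ?_
  set g : LGConfig d G → ℝ := fun σ => ∫ U, F U ∂(ymSpecification ρ β Λ₀ σ) with hg
  have hgc : Continuous g := continuous_integral_ymSpecification ρ hρ β Λ₀ hFc hC
  have hgb : ∀ σ, |g σ| ≤ C := fun σ => abs_integral_ymSpecification_le ρ hρ β Λ₀ hC σ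
  let Fb : BoundedContinuousFunction (LGConfig d G) ℝ :=
    BoundedContinuousFunction.ofNormedAddCommGroup F hFc C
      (fun U => by simpa [Real.norm_eq_abs] using hC U)
  let gb : BoundedContinuousFunction (LGConfig d G) ℝ :=
    BoundedContinuousFunction.ofNormedAddCommGroup g hgc C
      (fun U => by simpa [Real.norm_eq_abs] using hgb U)
  have h1 : Tendsto (fun k => ∫ U, Fb U ∂(P k : Measure (LGConfig d G))) atTop
      (𝓝 (∫ U, Fb U ∂(ν : Measure (LGConfig d G)))) :=
    (ProbabilityMeasure.tendsto_iff_forall_integral_tendsto.1 hlim) Fb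
  have h2 : Tendsto (fun k => ∫ σ, gb σ ∂(P k : Measure (LGConfig d G))) atTop
      (𝓝 (∫ σ, gb σ ∂(ν : Measure (LGConfig d G)))) :=
    (ProbabilityMeasure.tendsto_iff_forall_integral_tendsto.1 hlim) gb
  -- for large `k` the two sequences agree, by consistency
  have heq : ∀ᶠ k in atTop, ∫ σ, gb σ ∂(P k : Measure (LGConfig d G)) =
      ∫ U, Fb U ∂(P k : Measure (LGConfig d G)) := by
    filter_upwards [hΛ Λ₀] with k hk
    haveI := isProbabilityMeasure_ymSpecification ρ hρ β (Λ k) (η k)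
    have hint : Integrable F (ymSpecification ρ β (Λ k) (η k)) :=
      Integrable.of_bound hFc.measurable.aestronglyMeasurable C
        (ae_of_all _ fun U => by simpa [Real.norm_eq_abs] using hC U)
    simp only [hP k]
    exact integral_integral_ymSpecification_of_subset ρ hρ β hk (η k) hint
  exact (tendsto_nhds_unique (h2.congr' heq) h1).symm

/-- **Under DLR uniqueness the boundary-condition kernels converge to the DLR state**: if
`|𝒢(β)| ≤ 1` and `μ ∈ 𝒢(β)`, then for every choice of boundary conditions `η_k` and of finite
link sets `Λ_k` eventually containing every finite set, `∫ F dγ_{Λ_k}(· | η_k) → ∫ F dμ` for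
every bounded continuous `F` (compactness of the probability measures on the compact metrisable
configuration space, and the previous theorem). -/
theorem tendsto_integral_ymSpecification_of_subsingleton (hρ : Continuous ρ) (β : ℝ)
    (hsub : (ymGibbsMeasures (d := d) ρ β).Subsingleton) {μ : Measure (LGConfig d G)}
    (hμ : μ ∈ ymGibbsMeasures ρ β) {Λ : ℕ → Finset (ZdEdge d)}
    (hΛ : ∀ Λ₀ : Finset (ZdEdge d), ∀ᶠ k in atTop, Λ₀ ⊆ Λ k) (η : ℕ → LGConfig d G)
    {F : LGConfig d G → ℝ} (hFc : Continuous F) {C : ℝ} (hC : ∀ U, |F U| ≤ C) :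
    Tendsto (fun k => ∫ U, F U ∂(ymSpecification ρ β (Λ k) (η k))) atTop (𝓝 (∫ U, F U ∂μ)) := by
  haveI : IsProbabilityMeasure μ := hμ.1
  let P : ℕ → ProbabilityMeasure (LGConfig d G) := fun k =>
    ⟨ymSpecification ρ β (Λ k) (η k), isProbabilityMeasure_ymSpecification ρ hρ β (Λ k) (η k)⟩
  let μ' : ProbabilityMeasure (LGConfig d G) := ⟨μ, inferInstance⟩
  have hPμ : Tendsto P atTop (𝓝 μ') := by
    refine tendsto_of_subseq_tendsto fun ns hns => ?_
    obtain ⟨ν, -, ms, hms, hlim⟩ :=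
      (isCompact_univ (X := ProbabilityMeasure (LGConfig d G))).tendsto_subseq
        fun n => Set.mem_univ (P (ns n))
    refine ⟨ms, ?_⟩
    have hΛ' : ∀ Λ₀ : Finset (ZdEdge d), ∀ᶠ k in atTop, Λ₀ ⊆ Λ (ns (ms k)) := fun Λ₀ =>
      (hns.comp hms.tendsto_atTop).eventually (hΛ Λ₀)
    have hν : (ν : Measure (LGConfig d G)) ∈ ymGibbsMeasures ρ β :=
      mem_ymGibbsMeasures_of_tendsto_ymSpecification ρ hρ β hΛ' (fun k => η (ns (ms k)))
        (P := fun k => P (ns (ms k))) (fun _ => rfl) hlim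
    have hνμ : ν = μ' := Subtype.ext (hsub hν hμ)
    rw [← hνμ]
    exact hlim
  let Fb : BoundedContinuousFunction (LGConfig d G) ℝ :=
    BoundedContinuousFunction.ofNormedAddCommGroup F hFc C
      (fun U => by simpa [Real.norm_eq_abs] using hC U)
  exact (ProbabilityMeasure.tendsto_iff_forall_integral_tendsto.1 hPμ) Fb

omit [Group G] [TopologicalSpace G] [IsTopologicalGroup G] [CompactSpace G] [MeasurableSpace G]
  [BorelSpace G] [T2Space G] [SecondCountableTopology G] in
/-- The symmetric cubes `[-n, n]^d` eventually contain (the base points of) every finite link set. -/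
theorem eventually_subset_box_product (Λ₀ : Finset (ZdEdge d)) :
    ∀ᶠ n : ℕ in atTop, Λ₀ ⊆ box d n ×ˢ (Finset.univ : Finset (Fin d)) := by
  obtain ⟨R, hR⟩ : ∃ R : ℕ, ∀ e ∈ Λ₀, ∀ k, |e.1 k| ≤ R := by
    refine ⟨Λ₀.sup fun e => Finset.univ.sup fun k => (e.1 k).natAbs, fun e he k => ?_⟩
    have h1 : (e.1 k).natAbs ≤ Finset.univ.sup fun k => (e.1 k).natAbs :=
      Finset.le_sup (f := fun k => (e.1 k).natAbs) (Finset.mem_univ k)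
    have h2 : (Finset.univ.sup fun k => (e.1 k).natAbs) ≤
        Λ₀.sup fun e : ZdEdge d => Finset.univ.sup fun k => (e.1 k).natAbs :=
      Finset.le_sup (f := fun e : ZdEdge d => Finset.univ.sup fun k => (e.1 k).natAbs) he
    rw [Int.abs_eq_natAbs]
    exact_mod_cast h1.trans h2
  refine eventually_atTop.2 ⟨R, fun n hn e he => ?_⟩
  rw [Finset.mem_product]
  refine ⟨mem_box.2 fun k => ?_, Finset.mem_univ _⟩
  have h := abs_le.1 (hR e he k)
  have hn' : (R : ℤ) ≤ n := by exact_mod_cast hn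
  exact ⟨by omega, by omega⟩

end KernelLimits

/-! ## Diagonal RP of torus limit points under DLR uniqueness -/

section DiagonalRP

omit [Group G] [TopologicalSpace G] [IsTopologicalGroup G] [CompactSpace G] [MeasurableSpace G]
  [BorelSpace G] [T2Space G] [SecondCountableTopology G] in
/-- The diagonal swap of configurations is the axis transposition `(i j)` of `ClassB.lean`. -/
theorem configDiagSwapZd_eq_configPerm_swap (i j : Fin d) :
    (configDiagSwapZd (G := G) i j : LGConfig d G → LGConfig d G) = configPerm (Equiv.swap i j) := by
  funext U e
  simp only [configDiagSwapZd, configPerm, Equiv.symm_swap]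
  rfl

omit [Group G] [IsTopologicalGroup G] [CompactSpace G] [MeasurableSpace G] [BorelSpace G] [T2Space G]
  [SecondCountableTopology G] in
/-- The diagonal swap of configurations is continuous. -/
theorem continuous_configDiagSwapZd (i j : Fin d) : Continuous (configDiagSwapZd (G := G) i j) :=
  continuous_pi fun _ => continuous_apply _

/-- **The diagonal RP pairing of a DLR state is non-negative on continuous cylinder observables of
the half `{x_i ≥ x_j}` when the DLR state is unique** (`β ≥ 0`): the state is the weak limit of the
unit-boundary-condition kernels of the symmetric cubes, each of which is diagonal-RP. -/
theorem integral_diagSwap_nonneg_of_cylinder_of_subsingleton (hρ : Continuous ρ) {β : ℝ}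
    (hβ : 0 ≤ β) (hsub : (ymGibbsMeasures (d := d) ρ β).Subsingleton) {μ : Measure (LGConfig d G)}
    (hμ : μ ∈ ymGibbsMeasures ρ β) {i j : Fin d} (hij : i ≠ j) {F : LGConfig d G → ℂ}
    (hFc : Continuous F) {C : ℝ} (hC : ∀ U, ‖F U‖ ≤ C) (hFS : DependsOn F (diagHalfEdges i j)) :
    0 ≤ ∫ U, conj (F (configDiagSwapZd i j U)) * F U ∂μ := by
  haveI : IsProbabilityMeasure μ := hμ.1
  set H : LGConfig d G → ℂ := fun U => conj (F (configDiagSwapZd i j U)) * F U with hH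
  have hHc : Continuous H :=
    (Complex.continuous_conj.comp (hFc.comp (continuous_configDiagSwapZd i j))).mul hFc
  have hHb : ∀ U, ‖H U‖ ≤ C * C := fun U => by
    simp only [hH, norm_mul, Complex.norm_conj]
    exact mul_le_mul (hC _) (hC _) (norm_nonneg _) ((norm_nonneg (F U)).trans (hC U))
  -- the unit-boundary-condition kernels of the symmetric cubes converge to `μ`
  set γ : ℕ → Measure (LGConfig d G) := fun n =>
    ymSpecification ρ β (box d n ×ˢ (Finset.univ : Finset (Fin d))) 1 with hγ
  have hre : Tendsto (fun n => ∫ U, (H U).re ∂(γ n)) atTop (𝓝 (∫ U, (H U).re ∂μ)) :=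
    tendsto_integral_ymSpecification_of_subsingleton ρ hρ β hsub hμ
      (Λ := fun n => box d n ×ˢ (Finset.univ : Finset (Fin d))) eventually_subset_box_product
      (fun _ => 1) (Complex.continuous_re.comp hHc)
      (C := C * C) fun U => (Complex.abs_re_le_norm _).trans (hHb U)
  have him : Tendsto (fun n => ∫ U, (H U).im ∂(γ n)) atTop (𝓝 (∫ U, (H U).im ∂μ)) :=
    tendsto_integral_ymSpecification_of_subsingleton ρ hρ β hsub hμ
      (Λ := fun n => box d n ×ˢ (Finset.univ : Finset (Fin d))) eventually_subset_box_product
      (fun _ => 1) (Complex.continuous_im.comp hHc)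
      (C := C * C) fun U => (Complex.abs_im_le_norm _).trans (hHb U)
  -- each kernel pairing is non-negative (finite-volume diagonal RP)
  have hev : ∀ n, 0 ≤ ∫ U, (H U).re ∂(γ n) ∧ ∫ U, (H U).im ∂(γ n) = 0 := by
    intro n
    haveI := isProbabilityMeasure_ymSpecification ρ hρ β
      (box d n ×ˢ (Finset.univ : Finset (Fin d))) (1 : LGConfig d G)
    have hpos : 0 ≤ ∫ U, H U ∂(γ n) :=
      DiagRP.isReflectionPositiveFor_diag_ymSpecification_box ρ hρ hij hβ n F hFc.measurable
        ⟨C, hC⟩ hFS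
    have hint : Integrable H (γ n) :=
      Integrable.of_bound hHc.measurable.aestronglyMeasurable (C * C) (ae_of_all _ fun U => hHb _)
    obtain ⟨h1, h2⟩ := Complex.nonneg_iff.1 hpos
    have hre_eq : (∫ U, H U ∂(γ n)).re = ∫ U, (H U).re ∂(γ n) := by
      have h := integral_re hint
      simp only [RCLike.re_to_complex] at h
      exact h.symm
    have him_eq : (∫ U, H U ∂(γ n)).im = ∫ U, (H U).im ∂(γ n) := by
      have h := integral_im hint
      simp only [RCLike.im_to_complex] at h
      exact h.symm
    exact ⟨hre_eq ▸ h1, (him_eq ▸ h2).symm⟩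
  -- pass to the limit
  have hint : Integrable H μ :=
    Integrable.of_bound hHc.measurable.aestronglyMeasurable (C * C) (ae_of_all _ fun U => hHb _)
  have h1 : 0 ≤ ∫ U, (H U).re ∂μ :=
    ge_of_tendsto hre (Filter.Eventually.of_forall fun n => (hev n).1)
  have h2 : ∫ U, (H U).im ∂μ = 0 := by
    refine tendsto_nhds_unique him ?_
    exact tendsto_const_nhds.congr' (Filter.Eventually.of_forall fun n => (hev n).2.symm)
  have hre' : (∫ U, H U ∂μ).re = ∫ U, (H U).re ∂μ := by
    have h := integral_re hint
    simp only [RCLike.re_to_complex] at h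
    exact h.symm
  have him' : (∫ U, H U ∂μ).im = ∫ U, (H U).im ∂μ := by
    have h := integral_im hint
    simp only [RCLike.im_to_complex] at h
    exact h.symm
  refine Complex.nonneg_iff.2 ⟨?_, ?_⟩
  · rw [hre']; exact h1
  · rw [him', h2]

/-- **Diagonal RP of torus limit points under DLR uniqueness** (`β ≥ 0`, `i ≠ j`): if the
Wilson–DLR state at `β` is unique, every infinite-volume limit point of the torus Wilson states is
reflection positive in the hyperplane `x_i = x_j` in the sense of `ClassB.lean`. -/
theorem diagRP_of_mem_infiniteVolumeLimitPoints_of_subsingleton (hρ : Continuous ρ) {β : ℝ}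
    (hβ : 0 ≤ β) (hsub : (ymGibbsMeasures (d := d) ρ β).Subsingleton) {μ : Measure (LGConfig d G)}
    (hμ : μ ∈ infiniteVolumeLimitPoints (d := d) ρ β) {i j : Fin d} (hij : i ≠ j) :
    IsReflectionPositiveFor (configDiagSwapZd (G := G) i j) (diagHalfEdges i j) μ := by
  obtain ⟨φ, hφ, hprob, hconv⟩ := id hμ
  haveI := hprob
  have hG : μ ∈ ymGibbsMeasures ρ β := mem_ymGibbsMeasures_of_mem_infiniteVolumeLimitPoints_holds ρ hρ hμ
  have hΘ : MeasurePreserving (configDiagSwapZd (G := G) i j) μ μ := by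
    rw [configDiagSwapZd_eq_configPerm_swap]
    exact permInvariant_of_mem_infiniteVolumeLimitPoints ρ hρ hμ (Equiv.swap i j)
  exact IsReflectionPositiveFor.of_continuous_cylinder hΘ
    fun F T _ hFc ⟨C, hC⟩ hFS =>
      integral_diagSwap_nonneg_of_cylinder_of_subsingleton ρ hρ hβ hsub hG hij hFc hC hFS

/-- **`TorusLimitPointsDiagonalRP` under DLR uniqueness.** -/
theorem torusLimitPointsDiagonalRP_of_subsingleton (hρ : Continuous ρ) {β : ℝ} (hβ : 0 ≤ β)
    (hsub : (ymGibbsMeasures (d := d) ρ β).Subsingleton) : TorusLimitPointsDiagonalRP d ρ β :=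
  fun _ hμ _ _ hij => diagRP_of_mem_infiniteVolumeLimitPoints_of_subsingleton ρ hρ hβ hsub hμ hij

/-- **CLASS B HOLDS WHEREVER THE DLR STATE IS UNIQUE** (`β ≥ 0`, compact second countable `G`,
continuous `ρ`): if `|𝒢(β)| ≤ 1`, every infinite-volume limit point of the torus Wilson states is
(the measure of) a Class-B state of `ClassB.lean`. -/
theorem thermodynamicLimitIsClassB_of_subsingleton [NeZero d] (hρ : Continuous ρ) {β : ℝ} (hβ : 0 ≤ β)
    (hsub : (ymGibbsMeasures (d := d) ρ β).Subsingleton) : ThermodynamicLimitIsClassB d ρ β :=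
  (thermodynamicLimitIsClassB_iff ρ hρ hβ).2 (torusLimitPointsDiagonalRP_of_subsingleton ρ hρ hβ hsub)

end DiagonalRP

/-! ## `SU(N)` at strong coupling -/

section SpecialUnitary

/-- **CLASS B IS A THEOREM FOR `SU(N)` AT STRONG COUPLING.** For `d ≥ 2`, `N ≥ 2` and 't Hooft
coupling `0 ≤ β < 1/(16(d-1))` — bare Wilson coupling `Nβ`, fundamental representation — every
infinite-volume limit point of the torus Wilson states of `SU(N)` lattice Yang–Mills theory is a
Class-B state: translation/permutation/reflection invariant, obeying the one-link Haar-shift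
identity, and reflection positive in all site, link AND diagonal hyperplanes. (DLR uniqueness at
these couplings is the tree's `subsingleton_ymGibbsMeasures_SU_strongCoupling`; the limit point is
then the unique DLR state.) Strong coupling only: nothing is claimed at larger `β`. -/
theorem thermodynamicLimitIsClassB_SU_strongCoupling {d N : ℕ} (hd : 2 ≤ d) (hN : 2 ≤ N) {β : ℝ}
    (hβ0 : 0 ≤ β) (hβ : β < 1 / (16 * ((d : ℝ) - 1))) :
    ThermodynamicLimitIsClassB d (fundamentalRep (Fin N)) (N * β) := by
  haveI : NeZero d := ⟨by omega⟩
  -- `SU(N) ⊆ M_N(ℂ)` is second countable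
  haveI : SecondCountableTopology (Matrix (Fin N) (Fin N) ℂ) :=
    inferInstanceAs (SecondCountableTopology (Fin N → Fin N → ℂ))
  haveI : SecondCountableTopology (Matrix.specialUnitaryGroup (Fin N) ℂ) :=
    Topology.IsEmbedding.subtypeVal.secondCountableTopology
  have hN0 : (0 : ℝ) ≤ N := Nat.cast_nonneg N
  have hpos : (0 : ℝ) < 1 / (16 * ((d : ℝ) - 1)) := by
    have h2 : (2 : ℝ) ≤ d := by exact_mod_cast hd
    exact div_pos one_pos (by linarith)
  refine thermodynamicLimitIsClassB_of_subsingleton (fundamentalRep (Fin N))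
    (continuous_fundamentalRep (Fin N)) (mul_nonneg hN0 hβ0) ?_
  exact subsingleton_ymGibbsMeasures_SU_strongCoupling hd hN (abs_lt.2 ⟨by linarith, hβ⟩)

end SpecialUnitary

/-! ## Existence: under DLR uniqueness the DLR state itself is a Class-B state -/

section Existence

/-- **Under DLR uniqueness the unique DLR state is a Class-B state** (`β ≥ 0`): there is a
Class-B state `ω` whose measure is a DLR state, and every DLR state is `ω.μ`. (Torus limit points
exist by compactness — the tree's `infiniteVolumeLimitPoints_nonempty_holds` — and are DLR states,
hence equal to the unique one.) -/
theorem exists_classBState_of_subsingleton [NeZero d] (hρ : Continuous ρ) {β : ℝ} (hβ : 0 ≤ β)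
    (hsub : (ymGibbsMeasures (d := d) ρ β).Subsingleton) :
    ∃ ω : ClassBState d ρ β, ω.μ ∈ ymGibbsMeasures ρ β ∧ ∀ ν ∈ ymGibbsMeasures ρ β, ν = ω.μ := by
  obtain ⟨μ, hμ⟩ := infiniteVolumeLimitPoints_nonempty_holds (d := d) ρ hρ β
  obtain ⟨ω, hω⟩ := thermodynamicLimitIsClassB_of_subsingleton ρ hρ hβ hsub μ hμ
  have hG : ω.μ ∈ ymGibbsMeasures ρ β :=
    hω ▸ mem_ymGibbsMeasures_of_mem_infiniteVolumeLimitPoints_holds ρ hρ hμ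
  exact ⟨ω, hG, fun ν hν => hsub hν hG⟩

/-- In particular Class-B states EXIST wherever the DLR state is unique (`β ≥ 0`). -/
theorem nonempty_classBState_of_subsingleton [NeZero d] (hρ : Continuous ρ) {β : ℝ} (hβ : 0 ≤ β)
    (hsub : (ymGibbsMeasures (d := d) ρ β).Subsingleton) : Nonempty (ClassBState d ρ β) := by
  obtain ⟨ω, -⟩ := exists_classBState_of_subsingleton ρ hρ hβ hsub
  exact ⟨ω⟩

/-- **The infinite-volume `SU(N)` lattice Yang–Mills state at strong coupling is a Class-B state**:
for `d ≥ 2`, `N ≥ 2`, `0 ≤ β < 1/(16(d-1))` ('t Hooft coupling; bare coupling `Nβ`) there is a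
Class-B state `ω` of `ClassB.lean` whose measure is THE (unique) DLR state of the theory. This is the
object the lattice-bootstrap SDPs constrain — here, at strong coupling, all their Class-B axioms are
kernel-checked properties of it. Strong coupling only. -/
theorem exists_classBState_SU_strongCoupling {d N : ℕ} (hd : 2 ≤ d) (hN : 2 ≤ N) {β : ℝ}
    (hβ0 : 0 ≤ β) (hβ : β < 1 / (16 * ((d : ℝ) - 1))) :
    ∃ ω : ClassBState d (fundamentalRep (Fin N)) (N * β),
      ω.μ ∈ ymGibbsMeasures (d := d) (fundamentalRep (Fin N)) (N * β) ∧
        ∀ ν ∈ ymGibbsMeasures (d := d) (fundamentalRep (Fin N)) (N * β), ν = ω.μ := by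
  haveI : NeZero d := ⟨by omega⟩
  haveI : SecondCountableTopology (Matrix (Fin N) (Fin N) ℂ) :=
    inferInstanceAs (SecondCountableTopology (Fin N → Fin N → ℂ))
  haveI : SecondCountableTopology (Matrix.specialUnitaryGroup (Fin N) ℂ) :=
    Topology.IsEmbedding.subtypeVal.secondCountableTopology
  have hN0 : (0 : ℝ) ≤ N := Nat.cast_nonneg N
  have hpos : (0 : ℝ) < 1 / (16 * ((d : ℝ) - 1)) := by
    have h2 : (2 : ℝ) ≤ d := by exact_mod_cast hd
    exact div_pos one_pos (by linarith)
  exact exists_classBState_of_subsingleton (fundamentalRep (Fin N)) (continuous_fundamentalRep (Fin N))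
    (mul_nonneg hN0 hβ0)
    (subsingleton_ymGibbsMeasures_SU_strongCoupling hd hN (abs_lt.2 ⟨by linarith, hβ⟩))

end Existence

end Summit.QuantumFields.GaugeBoot
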